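import Summits.AtomisticToContinuum.Crystallization.Theses.PalmUnimodularRigidity
import Summits.AtomisticToContinuum.Crystallization.Theorems.MinimiserShells.Negative.LoadBearing
import Summits.AtomisticToContinuum.Crystallization.Theorems.MinimiserShells.Negative.Rootedness
import Summits.AtomisticToContinuum.Crystallization.Theorems.PalmUnimodularRigidityMinimiserShellsEquilibriumInLawShells
import Summits.AtomisticToContinuum.Crystallization.Theorems.PalmUnimodularRigidityMinimiserShellsEquilibriumInLawGainEvent
import Literature.Probability.Process.PointStationaryLaw
import Literature.MathematicalPhysics.StatisticalMechanics.RootEnergy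
import Literature.MathematicalPhysics.StatisticalMechanics.MuGSC

/-!
# Root energies as lattice sums, the depth penalty, and translating gains

Helper file for stub `stub_equilibriumInLaw` (S1) of line `equilibrium-in-law-surgery`, crux
`MinimiserShells` (stmt-AtomisticToContinuum-9225): deterministic ingredients of the assembly
(blueprint lemma 11).

* `Bδ δ = 250 δ⁻⁶ (δ⁻⁶/12 + 1/6)` — the crude bound on the Lennard-Jones field of a `δ`-separated
  set seen from one of its points; `tailBound δ j` — the depth penalty (`Bδ` near the boundary,
  `250 δ⁻⁴ (j − 1)⁻²` at integer depth `j ≥ max 1 δ + 1`), with `∑_j tailBound δ j ≤ CT δ`;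
* `integral_norm_count_restrict` / `abs_integral_norm_le` — the root energy of `count|S` is the
  lattice sum `∑_{z ∈ S} V_LJ(‖z‖)`, bounded by `Bδ` in absolute value;
  `integral_norm_count_restrict_image_sub` — re-rooted at `y ∈ S` it is `∑_{z ∈ S} V_LJ(|y − z|)`;
* `gain_translate` — a gaining modification of `S − y` at the root is a gaining modification of
  `S` centred at `y` (translation invariance of `U` and `I`).
-/

noncomputable section

open MeasureTheory
open scoped ENNReal BigOperators

namespace Summit.AtomisticToContinuum.Crystallization.Theorems.PalmUnimodularRigidityMinimiserShells.EquilibriumInLaw.RootSums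

open Literature.Probability.Process (IsPointStationaryLaw IsRootedHardCore count_restrict_singleton_ne_zero_iff
  map_sub_count_restrict)
open Literature.MathematicalPhysics.StatisticalMechanics (lennardJones IsMuGSC UniformlyDiscrete)
open Summit.AtomisticToContinuum.Crystallization.Theses.PalmUnimodularRigidity (MinimiserShells UnimodularEnergyLowerBound)
open Summit.AtomisticToContinuum.Crystallization.Theorems.MinimiserShells.Negative.LoadBearing
  (eStar meanRootEnergy GoodShell minimiserShells_iff)
open Literature.MathematicalPhysics.StatisticalMechanics (interactionEnergy fieldEnergy fieldEnergy_eq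
  interactionEnergy_add_const)
open Summit.AtomisticToContinuum.Crystallization.Theorems.MinimiserShells.Negative.Rootedness (E3
  countable_of_separated)
open Summit.AtomisticToContinuum.Crystallization.Theorems.PalmUnimodularRigidityMinimiserShells.EquilibriumInLaw.Shells
  (tsum_abs_lennardJones_le_crude)
open Summit.AtomisticToContinuum.Crystallization.Theorems.PalmUnimodularRigidityMinimiserShells.EquilibriumInLaw.GainEvent
  (measurable_lennardJones integral_count_restrict)

/-! ## Constants -/

/-- The crude bound on the Lennard-Jones field of a `δ`-separated set seen from one of its points. -/
def Bδ (δ : ℝ) : ℝ := 250 * δ⁻¹ ^ 6 * (δ⁻¹ ^ 6 / 12 + 1 / 6)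

/-- `Bδ ≥ 0`. -/
theorem Bδ_nonneg (δ : ℝ) : 0 ≤ Bδ δ := by unfold Bδ; positivity

/-- The depth penalty: the field from outside the cell felt by an atom at integer depth `j`. -/
def tailBound (δ : ℝ) (j : ℕ) : ℝ :=
  if max 1 δ + 1 ≤ (j : ℝ) then 250 * δ⁻¹ ^ 4 * ((j : ℝ) - 1)⁻¹ ^ 2 else Bδ δ

/-- The depth penalty is non-negative. -/
theorem tailBound_nonneg (δ : ℝ) (j : ℕ) : 0 ≤ tailBound δ j := by
  unfold tailBound
  split_ifs
  · positivity
  · exact Bδ_nonneg δ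

/-- A summable majorant constant for the depth penalties. -/
def CT (δ : ℝ) : ℝ := (max 1 δ + 2) * Bδ δ + 2000 * δ⁻¹ ^ 4

/-- `CT ≥ 0`. -/
theorem CT_nonneg (δ : ℝ) : 0 ≤ CT δ := by
  unfold CT
  have := Bδ_nonneg δ
  have : (0 : ℝ) ≤ max 1 δ := le_trans zero_le_one (le_max_left _ _)
  positivity

/-- **The depth penalties are summable**: every partial sum is `≤ CT δ`. -/
theorem sum_range_tailBound_le (δ : ℝ) (n : ℕ) : ∑ j ∈ Finset.range n, tailBound δ j ≤ CT δ := by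
  have h1 : (1 : ℝ) ≤ max 1 δ := le_max_left _ _
  rw [← Finset.sum_filter_add_sum_filter_not (Finset.range n) (fun j : ℕ => max 1 δ + 1 ≤ (j : ℝ))]
  have hA : ∑ j ∈ (Finset.range n).filter (fun j : ℕ => max 1 δ + 1 ≤ (j : ℝ)), tailBound δ j ≤
      2000 * δ⁻¹ ^ 4 := by
    have hsub : (Finset.range n).filter (fun j : ℕ => max 1 δ + 1 ≤ (j : ℝ)) ⊆ Finset.Ioo 0 n := by
      intro j hj
      rw [Finset.mem_filter, Finset.mem_range] at hj
      rw [Finset.mem_Ioo]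
      refine ⟨?_, hj.1⟩
      have : (2 : ℝ) ≤ j := by linarith [hj.2]
      exact_mod_cast (show (0 : ℝ) < j by linarith)
    calc ∑ j ∈ (Finset.range n).filter (fun j : ℕ => max 1 δ + 1 ≤ (j : ℝ)), tailBound δ j
        ≤ ∑ j ∈ (Finset.range n).filter (fun j : ℕ => max 1 δ + 1 ≤ (j : ℝ)),
            250 * δ⁻¹ ^ 4 * (4 * ((j : ℝ) ^ 2)⁻¹) := by
          refine Finset.sum_le_sum fun j hj => ?_
          have hj' := (Finset.mem_filter.1 hj).2
          rw [tailBound, if_pos hj']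
          have hj2 : (2 : ℝ) ≤ j := by linarith
          have hpos : (0 : ℝ) < (j : ℝ) - 1 := by linarith
          refine mul_le_mul_of_nonneg_left ?_ (by positivity)
          rw [inv_pow, ← one_div, ← one_div, mul_one_div, div_le_div_iff₀ (by positivity) (by positivity)]
          nlinarith
      _ = 1000 * δ⁻¹ ^ 4 * ∑ j ∈ (Finset.range n).filter (fun j : ℕ => max 1 δ + 1 ≤ (j : ℝ)),
            ((j : ℝ) ^ 2)⁻¹ := by rw [Finset.mul_sum]; refine Finset.sum_congr rfl fun j _ => by ring
      _ ≤ 1000 * δ⁻¹ ^ 4 * ∑ j ∈ Finset.Ioo 0 n, ((j : ℝ) ^ 2)⁻¹ := by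
          refine mul_le_mul_of_nonneg_left ?_ (by positivity)
          exact Finset.sum_le_sum_of_subset_of_nonneg hsub fun j _ _ => by positivity
      _ ≤ 1000 * δ⁻¹ ^ 4 * 2 := by
          refine mul_le_mul_of_nonneg_left ?_ (by positivity)
          have := sum_Ioo_inv_sq_le (α := ℝ) 0 n
          norm_num at this
          exact this
      _ = 2000 * δ⁻¹ ^ 4 := by ring
  have hB : ∑ j ∈ (Finset.range n).filter (fun j : ℕ => ¬ (max 1 δ + 1 ≤ (j : ℝ))), tailBound δ j ≤
      (max 1 δ + 2) * Bδ δ := by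
    have hsub : (Finset.range n).filter (fun j : ℕ => ¬ (max 1 δ + 1 ≤ (j : ℝ))) ⊆
        Finset.range (⌊max 1 δ⌋₊ + 2) := by
      intro j hj
      rw [Finset.mem_filter] at hj
      rw [Finset.mem_range]
      have hlt : (j : ℝ) < max 1 δ + 1 := not_le.1 hj.2
      have := Nat.lt_floor_add_one (max 1 δ)
      have : (j : ℝ) < ⌊max 1 δ⌋₊ + 2 := by linarith
      exact_mod_cast this
    calc ∑ j ∈ (Finset.range n).filter (fun j : ℕ => ¬ (max 1 δ + 1 ≤ (j : ℝ))), tailBound δ j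
        = ∑ j ∈ (Finset.range n).filter (fun j : ℕ => ¬ (max 1 δ + 1 ≤ (j : ℝ))), Bδ δ :=
          Finset.sum_congr rfl fun j hj => by rw [tailBound, if_neg (Finset.mem_filter.1 hj).2]
      _ ≤ ∑ _j ∈ Finset.range (⌊max 1 δ⌋₊ + 2), Bδ δ :=
          Finset.sum_le_sum_of_subset_of_nonneg hsub fun _ _ _ => Bδ_nonneg δ
      _ = (⌊max 1 δ⌋₊ + 2 : ℝ) * Bδ δ := by
          rw [Finset.sum_const, Finset.card_range, nsmul_eq_mul]; push_cast; ring
      _ ≤ (max 1 δ + 2) * Bδ δ := by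
          refine mul_le_mul_of_nonneg_right ?_ (Bδ_nonneg δ)
          have := Nat.floor_le (le_trans zero_le_one h1)
          linarith
  unfold CT
  linarith

/-- The depth penalties have `ℝ≥0∞`-sum at most `CT δ`. -/
theorem tsum_ofReal_tailBound_le (δ : ℝ) :
    ∑' j, ENNReal.ofReal (tailBound δ j) ≤ ENNReal.ofReal (CT δ) := by
  refine ENNReal.tsum_le_of_sum_range_le fun n => ?_
  rw [← ENNReal.ofReal_sum_of_nonneg fun j _ => tailBound_nonneg δ j]
  exact ENNReal.ofReal_le_ofReal (sum_range_tailBound_le δ n)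

/-! ## Root energies as lattice sums -/

/-- The Lennard-Jones field `z ↦ V_LJ(‖z − q‖)`-type functions are measurable. -/
theorem measurable_lennardJones_norm : Measurable fun z : E3 => lennardJones ‖z‖ :=
  measurable_lennardJones.comp measurable_norm

/-- **The root energy of a separated configuration is the lattice sum** `∑_{z ∈ S} V_LJ(‖z‖)`,
and this sum converges. -/
theorem integral_norm_count_restrict {δ : ℝ} (hδ : 0 < δ) {S : Set E3}
    (hsep : ∀ x ∈ S, ∀ y ∈ S, x ≠ y → δ ≤ dist x y) :
    Summable (fun z : S => lennardJones ‖(z : E3)‖) ∧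
      ∫ z, lennardJones ‖z‖ ∂(Measure.count : Measure E3).restrict S = ∑' z : S, lennardJones ‖(z : E3)‖ := by
  have hud : UniformlyDiscrete S := ⟨δ, hδ, hsep⟩
  have hsum : Summable fun z : S => lennardJones ‖(z : E3)‖ := by
    have := hud.summable_lennardJones 0
    refine this.congr fun z => ?_
    rw [dist_comm, dist_zero_right]
  exact ⟨hsum, integral_count_restrict (countable_of_separated hδ hsep) measurable_lennardJones_norm hsum⟩

/-- **The root energy of a rooted separated configuration is bounded**: `|∑_{z ∈ S} V_LJ(‖z‖)| ≤ Bδ`. -/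
theorem abs_integral_norm_le {δ : ℝ} (hδ : 0 < δ) {S : Set E3} (h0 : (0 : E3) ∈ S)
    (hsep : ∀ x ∈ S, ∀ y ∈ S, x ≠ y → δ ≤ dist x y) :
    |∫ z, lennardJones ‖z‖ ∂(Measure.count : Measure E3).restrict S| ≤ Bδ δ := by
  rw [(integral_norm_count_restrict hδ hsep).2]
  have h := (tsum_abs_lennardJones_le_crude (T := S) 0 hδ
    (fun z hz hz0 => hsep 0 h0 z hz (Ne.symm hz0)) hsep).2
  have heq : (fun z : S => lennardJones (dist (0 : E3) z)) = fun z : S => lennardJones ‖(z : E3)‖ := by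
    funext z; rw [dist_comm, dist_zero_right]
  rw [heq] at h
  exact h

/-- **The root energy after re-rooting at an atom `y`**: for the configuration `S − y`,
`∑_{w ∈ S − y} V_LJ(‖w‖) = ∑_{z ∈ S} V_LJ(|y − z|)`. -/
theorem integral_norm_count_restrict_image_sub {δ : ℝ} (hδ : 0 < δ) {S : Set E3}
    (hsep : ∀ x ∈ S, ∀ y ∈ S, x ≠ y → δ ≤ dist x y) (y : E3) :
    ∫ z, lennardJones ‖z‖ ∂(Measure.count : Measure E3).restrict ((fun z => z - y) '' S) =
      ∑' z : S, lennardJones (dist y z) := by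
  have hsep' : ∀ x ∈ (fun z => z - y) '' S, ∀ x' ∈ (fun z => z - y) '' S, x ≠ x' → δ ≤ dist x x' := by
    rintro _ ⟨a, ha, rfl⟩ _ ⟨b, hb, rfl⟩ hne
    rw [dist_sub_right]
    exact hsep a ha b hb fun h => hne (by rw [h])
  rw [(integral_norm_count_restrict hδ hsep').2]
  have himg : (fun z => z - y) '' S = (Equiv.subRight y) '' S := rfl
  rw [tsum_congr_set_coe (fun w => lennardJones ‖w‖) himg,
    ← Equiv.tsum_eq (Equiv.image (Equiv.subRight y) S) (fun w => lennardJones ‖(w : E3)‖)]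
  refine tsum_congr fun z => ?_
  change lennardJones ‖(z : E3) - y‖ = lennardJones (dist y z)
  rw [← dist_eq_norm, dist_comm]

/-! ## Translating a gain from the re-rooted configuration back to the atom -/

/-- **Translating a gaining modification.** If in `S − y` the modification "remove `xf'`, insert
`R'`" (all within `r` of the root) is admissible and gains `≥ ε`, then in `S` the translated
modification "remove `xf' + y`, insert `R' + y`" (all within `r` of `y`) is admissible and gains
`≥ ε`. -/
theorem gain_translate {S : Set E3} (y : E3) {n₀ k : ℕ} {r ε : ℝ} {xf' : Fin n₀ → E3} {R' : Fin k → E3}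
    (hinj : Function.Injective xf') (hxS : Set.range xf' ⊆ (fun z => z - y) '' S)
    (hxr : ∀ l, ‖xf' l‖ ≤ r) (hRinj : Function.Injective R') (hRr : ∀ i, ‖R' i‖ ≤ r)
    (hdisj : Disjoint (Set.range R') ((fun z => z - y) '' S \ Set.range xf'))
    (hineq : interactionEnergy lennardJones R' +
        fieldEnergy lennardJones R' ((fun z => z - y) '' S \ Set.range xf') - eStar * k + ε ≤
      interactionEnergy lennardJones xf' +
        fieldEnergy lennardJones xf' ((fun z => z - y) '' S \ Set.range xf') - eStar * n₀) :
    ∃ (xf : Fin n₀ → E3) (R : Fin k → E3),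
      Function.Injective xf ∧ Set.range xf ⊆ S ∧ (∀ l, dist (xf l) y ≤ r) ∧
      Function.Injective R ∧ (∀ i, dist (R i) y ≤ r) ∧ Disjoint (Set.range R) (S \ Set.range xf) ∧
      interactionEnergy lennardJones R + fieldEnergy lennardJones R (S \ Set.range xf) - eStar * k + ε ≤
        interactionEnergy lennardJones xf + fieldEnergy lennardJones xf (S \ Set.range xf) - eStar * n₀ := by
  set xf : Fin n₀ → E3 := fun l => xf' l + y with hxf
  set R : Fin k → E3 := fun i => R' i + y with hR
  -- membership in `S − y`
  have hmemS : ∀ w : E3, w ∈ (fun z => z - y) '' S ↔ w + y ∈ S := by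
    intro w
    constructor
    · rintro ⟨s, hs, rfl⟩; rwa [sub_add_cancel]
    · intro h; exact ⟨w + y, h, add_sub_cancel_right w y⟩
  have hrange : ∀ w : E3, w + y ∈ Set.range xf ↔ w ∈ Set.range xf' := by
    intro w
    simp only [hxf, Set.mem_range]
    constructor
    · rintro ⟨l, hl⟩; exact ⟨l, add_right_cancel hl⟩
    · rintro ⟨l, rfl⟩; exact ⟨l, rfl⟩
  -- the bijection between the two environments
  have hiff : ∀ w : E3, w ∈ (fun z => z - y) '' S \ Set.range xf' ↔ w + y ∈ S \ Set.range xf := by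
    intro w
    rw [Set.mem_sdiff, Set.mem_sdiff, hmemS, hrange]
  set e : ↥((fun z => z - y) '' S \ Set.range xf') ≃ ↥(S \ Set.range xf) :=
    (Equiv.addRight y).subtypeEquiv hiff with he
  have hfield : ∀ q : E3, ∑' z : ↥(S \ Set.range xf), lennardJones (dist (q + y) z) =
      ∑' w : ↥((fun z => z - y) '' S \ Set.range xf'), lennardJones (dist q w) := by
    intro q
    rw [← Equiv.tsum_eq e]
    refine tsum_congr fun w => ?_
    change lennardJones (dist (q + y) ((w : E3) + y)) = _
    rw [dist_add_right]
  refine ⟨xf, R, fun a b h => hinj (add_right_cancel h), ?_, ?_, fun a b h => hRinj (add_right_cancel h),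
    ?_, ?_, ?_⟩
  · rintro _ ⟨l, rfl⟩
    exact (hmemS _).1 (hxS (Set.mem_range_self l))
  · intro l
    change dist (xf' l + y) y ≤ r
    rw [dist_eq_norm, add_sub_cancel_right]
    exact hxr l
  · intro i
    change dist (R' i + y) y ≤ r
    rw [dist_eq_norm, add_sub_cancel_right]
    exact hRr i
  · refine Set.disjoint_left.2 ?_
    rintro _ ⟨i, rfl⟩ hmem
    have : R' i ∈ (fun z => z - y) '' S \ Set.range xf' := (hiff _).2 hmem
    exact Set.disjoint_left.1 hdisj (Set.mem_range_self i) this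
  · rw [fieldEnergy_eq, fieldEnergy_eq] at hineq ⊢
    have h1 : interactionEnergy lennardJones R = interactionEnergy lennardJones R' :=
      interactionEnergy_add_const lennardJones R' y
    have h2 : interactionEnergy lennardJones xf = interactionEnergy lennardJones xf' :=
      interactionEnergy_add_const lennardJones xf' y
    rw [h1, h2]
    simp only [hxf, hR, hfield]
    exact hineq

/-- Registered stub marker (helper part 11/14 of `stub_equilibriumInLaw`, line `equilibrium-in-law-surgery`):
the root energy of a rooted separated configuration is a bounded lattice sum, `abs_integral_norm_le`, closed form. -/
theorem stub_equilibriumInLaw_part11 :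
    ∀ (δ : ℝ), 0 < δ → ∀ (S : Set (EuclideanSpace ℝ (Fin 3))), (0 : EuclideanSpace ℝ (Fin 3)) ∈ S →
      (∀ x ∈ S, ∀ y ∈ S, x ≠ y → δ ≤ dist x y) →
      |∫ z, lennardJones ‖z‖ ∂(Measure.count : Measure (EuclideanSpace ℝ (Fin 3))).restrict S| ≤ Bδ δ :=
  fun _ hδ _ h0 hsep => abs_integral_norm_le hδ h0 hsep

end Summit.AtomisticToContinuum.Crystallization.Theorems.PalmUnimodularRigidityMinimiserShells.EquilibriumInLaw.RootSums

end
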